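import Summits.QuantumFields.QCD.Theses.SpectralDefectExtinction
import Summits.QuantumFields.QCD.Theorems.ExtinctionBuildsQCD.Negative.InertiaPencil
import Summits.QuantumFields.QCD.Theorems.ExtinctionBuildsQCD.Negative.ChiralInertia
import Summits.QuantumFields.QCD.Theorems.SpectralDefectExtinctionTipPricingFluxRegionCoercive
import Summits.QuantumFields.QCD.Theorems.SpectralDefectExtinctionTipPricingWallBlockGapHalf
import Literature.MathematicalPhysics.QuantumLattice.OverlapLocality
import Literature.Probability.LatticeModels.ThermodynamicLimit
import Literature.MathematicalPhysics.QuantumFieldTheory.QCD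

/-!
# Wall block: gap and inertia exactly half (sub-goal `wallBlock_gap_and_half` of crux stmt-QuantumFields-8967)

Deterministic lemma (G3) of the modular cell–wall template (crux idea `Cruxes/TipPricing/Ideas/modular-cell-wall-template.md`,
lead c2; serves stub `stub_spreadOfCells` of line `hermitian-flow-coarea` r3): on a flux-patterned region `S` inside an embedded box
(hypotheses as in `fluxRegion_hopping_form_le`), the principal block `A` of `Γ₅ D_W(U, −δ, 1)` over the quark indices of `S` has
the norm gap `(3/8 − δ − 12η)²‖v‖² ≤ ‖A v‖²`, exactly `6·|S|` negative characteristic roots (inertia half), and is invertible.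
Route: `Re⟨v, (D_W − δ)_S v⟩ = (4 − δ)‖v‖² − Σ_μ Re⟨ṽ, W_μ ṽ⟩` (`wilsonDirac_eq_sub_sum_wilsonHop`, `ṽ` = extension by zero),
`Re⟨ṽ, W_μ ṽ⟩ = Σ_spin Re⟨φ_s, F_μ φ_s⟩` (`wilsonHop = F_μ ⊗ P₋ + F_μᴴ ⊗ P₊`, `P_± ` complementary projections commuting with `F_μ ⊗ 1`),
`fluxRegion_hopping_form_le` per spin component, so `Re⟨v,(D_W − δ)_S v⟩ ≥ (3/8 − δ − 12η)‖v‖²`; then `‖A v‖ = ‖(D_W−δ)_S v‖`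
(`Γ₅` is site-diagonal and unitary), Cauchy–Schwarz for the gap, and `countP_neg_eq_of_chiral` with the `Γ₅ = ±1` coordinate
sub-bases for the inertia.  Supports stmt-QuantumFields-8967 (helper; closes no item).
-/

noncomputable section

namespace Summit.QuantumFields.QCD.Cruxes.TipPricing.ModularTemplate

open Matrix
open Literature.MathematicalPhysics.QuantumLattice Literature.MathematicalPhysics.QuantumFieldTheory
  Literature.Probability.LatticeModels
open Summit.QuantumFields.QCD.Theorems.ExtinctionBuildsQCD.Negative (negRootCount)
open scoped BigOperators Classical

/-- **Wall block of `Γ₅(D_W − δ)` on a flux-patterned region: norm gap, inertia exactly half, invertible.** [folklore] -/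
theorem wallBlock_gap_and_half {n : ℕ} [NeZero n] (U : GaugeConfig 4 n SU3) (c : Fin 4 → ℤ) (R : ℕ)
    (hR : 2 * R + 1 < n) (S : Set (TorusSite 4 n)) (η δ : ℝ) (hη : 0 ≤ η) (hδ : δ + 12 * η < 3 / 8)
    (hS : ∀ x ∈ S, ∃ y : Fin 4 → ℤ, y ∈ box 4 R ∧ Torus.proj n (c + y) = x)
    (hflux : ∀ y : Fin 4 → ℤ, y ∈ box 4 R → Torus.proj n (c + y) ∈ S → ∀ μ : Fin 4,
      Torus.proj n (c + y + Pi.single μ 1) ∈ S → ∀ i j : Fin 3,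
        ‖(↑(U (Torus.proj n (c + y), μ)) : Matrix (Fin 3) (Fin 3) ℂ) i j -
          (if i = j then (if μ = 1 then Complex.exp (2 * Real.pi * Complex.I * ((y 0 : ℤ) : ℂ) / 3)
            else if μ = 3 then Complex.exp (2 * Real.pi * Complex.I * ((y 2 : ℤ) : ℂ) / 3) else 1) else 0)‖ ≤ η) :
    (∀ v : {p : TorusSite 4 n × Fin 3 × Fin 4 // p.1 ∈ S} → ℂ,
      (3 / 8 - δ - 12 * η) ^ 2 * ∑ i, ‖v i‖ ^ 2 ≤
        ∑ i, ‖(((spinorLift gammaFive * wilsonDirac (fundamentalRep (Fin 3)) U (-δ) 1).submatrix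
          (Subtype.val : {p : TorusSite 4 n × Fin 3 × Fin 4 // p.1 ∈ S} → _) Subtype.val) *ᵥ v) i‖ ^ 2) ∧
    negRootCount ((spinorLift gammaFive * wilsonDirac (fundamentalRep (Fin 3)) U (-δ) 1).submatrix
        (Subtype.val : {p : TorusSite 4 n × Fin 3 × Fin 4 // p.1 ∈ S} → _) Subtype.val) =
      6 * Fintype.card {x : TorusSite 4 n // x ∈ S} ∧
    ((spinorLift gammaFive * wilsonDirac (fundamentalRep (Fin 3)) U (-δ) 1).submatrix
        (Subtype.val : {p : TorusSite 4 n × Fin 3 × Fin 4 // p.1 ∈ S} → _) Subtype.val).det ≠ 0 := by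
  have h := wallBlock_gap_and_half_of_hop U S δ (4 - 3 / 8 + 12 * η) (by linarith)
    (fun φ hφ => fluxRegion_hopping_form_le U c R hR S η hη hS hflux φ hφ)
  have hc : (4 - δ - (4 - 3 / 8 + 12 * η)) = 3 / 8 - δ - 12 * η := by ring
  rw [hc] at h
  exact h

end Summit.QuantumFields.QCD.Cruxes.TipPricing.ModularTemplate

end
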